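import Literature.MathematicalPhysics.QuantumFieldTheory.Balaban1983to89.B8CprimeCurveAnalytic

/-!
# `Balaban1983to89.B8Eq1118PicardAnalytic` — T. Bałaban, *Spaces of regular gauge field configurations on a lattice and gauge fixing
# conditions*, Commun. Math. Phys. **99** (1985) 75–102 [Balaban1985RegularSpaces], Sect. E pp. 96–97: the transformation (1.118)
# `X → C′(λ − H′X)` and its contraction-mapping iterates ALONG HOLOMORPHIC FAMILIES OF `λ`'s, for the CONCRETE lattice remainder `C′`
# (file 2 of 3 towards p. 97 «This solution is an analytic function of λ»; file 1 = `B8CprimeCurveAnalytic`, file 3 = `B8Eq1117ConcreteAnalytic`)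

statement-level skeleton of published theorems with citation tags; proofs where landed; nothing here is a claim about the Yang–Mills mass gap

PDF held: `paper:balaban1985-cmp99-regular-spaces-gauge-fixing` (journal page = PDF page + 74); pp. 96–97 [PDF 22–23] read from the text
layer (this unit, 2026-08-21); [3] = [Balaban1985Averaging], (207)–(208), (213)–(214) p. 50.

CITATION HEADER (lean-in-tree rule).  Cell `lit-balaban` (HOME `run/shared/lean/pub/lit-balaban/`), unit `lit-balaban-p05` (Phase-2 proof
seat p05, gen 6; TAKING line HOME/STATUS.md 2026-08-21T09:39:21Z; free-target protocol G.5-34(d); owner of block B8 = `lit-balaban-r05`,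
referee ref-4).  Rows served: **`B8.Eq1.113`** / **`B8.Claim@97`** (p. 97 «exactly one solution … This solution is an analytic function
of λ») for the CONCRETE `C′ = B8Eq1117Concrete.CnlF`, `D′ = B8Eq1113Concrete.Dprime` (this unit, gen 5), `H′` abstract as there.

PRINT (p. 96 [PDF 22] – p. 97 [PDF 23], verbatim).  «The function D′(λ) is a solution of the equation C′(λ − H′X) = X, (1.117) or a
fixed point of the transformation X → C′(λ − H′X). (1.118) … by the inequality (214) we have |C′(λ − H′X)| < C′₂(α₃ + α₄)α₄, (1.121)
… The transformation (1.118) maps the set (1.119) of X's into itself if C′₂(α₃ + α₄)α₄ ≦ α₄/(2B′₀) … We may admit configurations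
λ, X with values in the complexified algebra 𝔤ᶜ and all the above equations and inequalities are valid also. … |C′(λ − H′X₁) −
C′(λ − H′X₂)| ≦ C′₂2B′₀(α₃ + α₄)|X₁ − X₂|, hence the mapping (1.118) is contractive if e.g. α₃ + α₄ ≦ 1/(4B′₀C′₂). If the last
condition is satisfied, then the mapping transforms the set {|X| < α₄/(2B′₀)} into itself and is contractive on this set. Thus by
the contraction mapping theorem there exists exactly one solution of Eq. (1.117). This solution is an analytic function of λ defined
on the set of λ satisfying (1.119).»

WHAT THIS FILE PROVES (kernel, no `sorry`, standard axioms; theorems only — no `def`, no `… : Prop` fact; hypotheses = those of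
`B8Eq1117Concrete.eq1117_existsUnique`: `𝔸` complete normed `ℂ`-algebra with `‖1‖ = 1`, `U₀` `G`-valued with (52), `η = L⁻ᵏ`,
`u₁ ∈ Λ_k(U₀, α₃)`, `H′ : XSpace →ₗ[ℂ] (ℤᵈ → 𝔸)` with `‖(H′X)(x)‖ ≤ B′₀‖X‖`, `‖R(U₀(b))(H′X)(b₊) − (H′X)(b₋)‖ ≤ B′₀‖X‖η`, print's
smallness `α₃ + α₄ ≦ 1/(4B′₀C′₂)` with `C′₂ := 2·C2p d` — READING (c) of `B8Eq1117Concrete`, GAPS G-B8-17):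
* §1 `fpMap_apply_norm` — (1.118) on the set (1.119): coordinates `C′_j(u₁, λ − H′X)(z)` and the bound (1.121) `‖C′(λ − H′X)‖ ≤
  C′₂(α₃ + α₄)α₄` («maps the set (1.119) of X's into itself»); `norm_fpMap_sub_le` — «the mapping (1.118) is contractive» with
  constant `½` on the ball `‖X‖ ≤ α₄/(2B′₀)`.  (Both extracted from the proof of `B8Eq1117Concrete.eq1117_existsUnique`.)
* §2 `differentiableOn_fpMap_comp` — along a sitewise-holomorphic family `γ : V → (ℤᵈ → 𝔸)` (`V ⊂ ℂ` open) with values in (1.119)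
  and a holomorphic `X : V → XSpace` in the ball, `t ↦ C′(γ(t) − H′X(t))` is complex differentiable (`XSpace`-valued): (1.119) ⇒
  (1.120) (`dom120_of_119`) and file 1's `differentiableOn_CnlF_comp` («the analyticity properties of C′(λ)», Banach-valued).
* §3 `picard_iterate` — the contraction-mapping iterates `X₀ = 0`, `X_{n+1}(t) = C′(γ(t) − H′X_n(t))` stay in the ball, are complex
  differentiable on `V`, and satisfy `‖X_n(t) − D′(γ(t))‖ ≤ 2⁻ⁿα₄/(2B′₀)`; `tendstoUniformlyOn_picard` — they converge to `D′(γ(·))`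
  uniformly on `V`.  (File 3 concludes: the uniform limit of holomorphic maps is holomorphic.)
READINGS: (a)–(d) of `B8Eq1117Concrete` (one-level (207)-domain, `𝔤ᶜ`-values, `H′` abstract, constants, closed ball); «analytic in λ» in
the curve form of `B8CprimeCurveAnalytic` READING (a).  NOT CLAIMED: the lattice `H′` (row B8.Eq1.91); Fréchet analyticity on a Banach
space of `λ`'s (r05 `B8Eq1119LambdaSpace` + the tree's Graves–Taylor–Hille–Zorn, not knitted here).
REUSED BY NAME: `B8Eq1117Concrete.XSpace, CnlF, CnlF_apply, fpMap, norm_Cnl_le_of207, dom120_of_119`, `B8Eq1113Concrete.Dprime, Dprime_spec`,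
`B8Eq1122Concrete.lipschitz1122`, `B8Ineq125Concrete.C2p, C2p_nonneg`, `B8CprimeCurveAnalytic.differentiableOn_CnlF_comp`, Mathlib
`Function.iterate_succ_apply'`, `Metric.tendstoUniformlyOn_iff`, `tendsto_pow_atTop_nhds_zero_of_lt_one`, `LinearMap.mkContinuous`.
Unit `lit-balaban-p05` (gen 6), 2026-08-21.  Nothing here is new mathematics.

[cite: Balaban1985RegularSpaces, (1.117)–(1.121) p.96, p.97 (contraction of (1.118); «exactly one solution»; «This solution is an analytic
function of λ defined on the set of λ satisfying (1.119)»); Balaban1985Averaging, (214) p.50]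
-/

noncomputable section

open NormedSpace Finset Metric Set Filter
open scoped BoundedContinuousFunction Topology NNReal

namespace Literature.MathematicalPhysics.QuantumFieldTheory.Balaban1983to89.B8Eq1118PicardAnalytic

open B7Prop1Explicit B7Prop2Explicit MatrixLog B7Eq167Flat B7Prop9Flat B7Prop10General
open B7Prop10Flat (one_le_C5 C4'_nonneg C5'_nonneg)
open B7Eq214General (Cgen)
open B7Eq170Flat (cj)
open B8Eq1123Concrete (Cnl)
open B8Ineq125Concrete (C2p C2p_nonneg)
open B8Eq1122Concrete (lipschitz1122)
open B8Eq1117Concrete (XSpace CnlF CnlF_apply fpMap norm_Cnl_le_of207 dom120_of_119)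
open B8Eq1113Concrete (Dprime Dprime_spec)
open B8CprimeCurveAnalytic (differentiableOn_CnlF_comp)

-- `Site` alone would resolve to the torus sites of `Setup.lean`; re-export the `ℤ^d` sites of `B7Prop1Explicit`.
export B7Prop1Explicit (Site)

variable {d : ℕ}

/-! ## §1 The transformation (1.118) `X → C′(λ − H′X)`: coordinates, self-map bound, contraction -/

section FpMap

variable {𝔸 : Type*} [NormedRing 𝔸] [NormOneClass 𝔸] [NormedAlgebra ℂ 𝔸] [CompleteSpace 𝔸]

/-- **(1.118) on the set (1.119): coordinates and the bound (1.121).**  For `λ` in the half-size set (1.119), `‖X‖ ≤ α₄/(2B′₀)` and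
`H′` with the modulus bounds of `B8Eq1117Concrete` READING (b): `λ − H′X` lies in (1.120) (`dom120_of_119`), so the packaged
`C′(λ − H′X) = fpMap … λ X` has coordinates `C′_j(u₁, λ − H′X)(z)` and norm `≤ C′₂(α₃ + α₄)α₄` (`C′₂ = C2p d`) — print p. 96:
«by the inequality (214) we have |C′(λ − H′X)| < C′₂(α₃ + α₄)α₄, (1.121) … The transformation (1.118) maps the set (1.119) of
X's into itself if C′₂(α₃ + α₄)α₄ ≦ α₄/(2B′₀)».  (Extracted from the proof of `B8Eq1117Concrete.eq1117_existsUnique`.)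
[cite: Balaban1985RegularSpaces, (1.118)–(1.121) p.96] -/
theorem fpMap_apply_norm {L : ℕ} (hL : 2 ≤ L) {G : Subgroup 𝔸ˣ} (hG : AvgClosed d L G) {U₀ : Site d → Fin d → 𝔸ˣ}
    (hU : ∀ x κ, U₀ x κ ∈ G) {k : ℕ} (H' : XSpace d k 𝔸 →ₗ[ℂ] (Site d → 𝔸)) {lam : Site d → 𝔸}
    {u₁ : Site d → 𝔸ˣ} {α₀ α₃ α₄ B₀' : ℝ}
    (hα : 0 < α₀) (hα3 : C0 d * α₀ ≤ 1 / 3) (hα2 : 2 * α₀ ≤ c2' d L)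
    (h52 : pdev U₀ < α₀ * (((L : ℝ) ^ k)⁻¹) ^ 2)
    (hB : 0 < B₀')
    (hH0 : ∀ (X : XSpace d k 𝔸) (x : Site d), ‖H' X x‖ ≤ B₀' * ‖X‖)
    (hH1 : ∀ (X : XSpace d k 𝔸) (x : Site d) (κ : Fin d),
      ‖cj (U₀ x κ) (H' X (x + e κ)) - H' X x‖ ≤ B₀' * ‖X‖ * ((L : ℝ) ^ k)⁻¹)
    (h119a : ∀ (x : Site d) (κ : Fin d), ‖cj (U₀ x κ) (lam (x + e κ)) - lam x‖ < α₄ / 2 * ((L : ℝ) ^ k)⁻¹)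
    (h119b : ∀ x : Site d, ‖lam x‖ < α₄ / 2)
    (hu₁ : InLambda L U₀ u₁ k α₃ (((L : ℝ) ^ k)⁻¹))
    (hα₃ : 0 ≤ α₃) (hα₃' : α₃ ≤ 1 / 200)
    (hs₁ : 200 * C6 d * α₄ ≤ 1) (hs₂ : 12000 * ((d : ℝ) + 1) * L * α₄ ≤ 1) (hs₃ : C4G d L * (α₀ + α₃ + 4 * α₄) ≤ 1)
    (hs₄ : 1024 * ((d : ℝ) + 1) * ((d : ℝ) + 4) * L ^ 2 * α₀ ≤ 1) (hs₅ : 32 * ((d : ℝ) + 1) ^ 2 * C6 d * L ^ 2 * α₀ ≤ 1)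
    (hs₆ : 16 * d * C5' d * C6 d * (L : ℝ) ^ 2 * α₀ ≤ 1) (hs₇ : 8 * d * C6 d * L * α₀ ≤ 1)
    {X : XSpace d k 𝔸} (hX : ‖X‖ ≤ α₄ / (2 * B₀')) :
    (∀ p : Fin (k + 1) × Site d, fpMap L U₀ u₁ k H' lam X p = Cnl L U₀ u₁ p.1 (lam - H' X) p.2) ∧
      ‖fpMap L U₀ u₁ k H' lam X‖ ≤ C2p d * (α₃ + α₄) * α₄ := by
  have hs : (0 : ℝ) ≤ ((L : ℝ) ^ k)⁻¹ := by positivity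
  obtain ⟨ha, hb⟩ := dom120_of_119 H' hB hs hH0 hH1 h119a h119b hX
  have hpt : ∀ p : Fin (k + 1) × Site d, ‖Cnl L U₀ u₁ p.1 (lam - H' X) p.2‖ ≤ C2p d * (α₃ + α₄) * α₄ := fun p =>
    norm_Cnl_le_of207 hL hG hU hα hα3 hα2 h52 ha hb hu₁ hα₃ hα₃' hs₁ hs₂ hs₃ hs₄ hs₅ hs₆ hs₇ p.1
      (Nat.le_of_lt_succ p.1.isLt) p.2
  have hbdd : ∃ C : ℝ, ∀ p : Fin (k + 1) × Site d, ‖Cnl L U₀ u₁ p.1 (lam - H' X) p.2‖ ≤ C := ⟨_, hpt⟩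
  have happ : ∀ p : Fin (k + 1) × Site d, fpMap L U₀ u₁ k H' lam X p = Cnl L U₀ u₁ p.1 (lam - H' X) p.2 :=
    fun p => by rw [fpMap, CnlF_apply hbdd]
  have hα₄ : 0 < α₄ := by linarith [norm_nonneg (lam 0), h119b 0]
  have h0 : 0 ≤ C2p d * (α₃ + α₄) * α₄ := by have := C2p_nonneg d; positivity
  exact ⟨happ, (BoundedContinuousFunction.norm_le h0).2 fun p => by rw [happ]; exact hpt p⟩

/-- **«the mapping (1.118) is contractive»** (p. 97) as a standalone estimate for the concrete `C′` (extracted from the proof of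
`B8Eq1117Concrete.eq1117_existsUnique`, same hypotheses — the (214)-hypotheses at `2α₄`, READING (c) of that file / GAPS G-B8-17):
for `λ` in the half-size set (1.119) and `‖X‖, ‖Y‖ ≤ α₄/(2B′₀)`,  `‖C′(λ − H′X) − C′(λ − H′Y)‖ ≤ ½‖X − Y‖` — print: «|C′(λ − H′X₁) −
C′(λ − H′X₂)| ≦ C′₂2B′₀(α₃ + α₄)|X₁ − X₂|, hence the mapping (1.118) is contractive if e.g. α₃ + α₄ ≦ 1/(4B′₀C′₂)».
[cite: Balaban1985RegularSpaces, p.97 (contraction of (1.118)), (1.122)/(1.125) pp.96–97] -/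
theorem norm_fpMap_sub_le {L : ℕ} (hL : 2 ≤ L) {G : Subgroup 𝔸ˣ} (hG : AvgClosed d L G) {U₀ : Site d → Fin d → 𝔸ˣ}
    (hU : ∀ x κ, U₀ x κ ∈ G) {k : ℕ} (H' : XSpace d k 𝔸 →ₗ[ℂ] (Site d → 𝔸)) {lam : Site d → 𝔸}
    {u₁ : Site d → 𝔸ˣ} {α₀ α₃ α₄ B₀' : ℝ}
    (hα : 0 < α₀) (hα3 : C0 d * α₀ ≤ 1 / 3) (hα2 : 2 * α₀ ≤ c2' d L)
    (h52 : pdev U₀ < α₀ * (((L : ℝ) ^ k)⁻¹) ^ 2)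
    (hB : 0 < B₀')
    (hH0 : ∀ (X : XSpace d k 𝔸) (x : Site d), ‖H' X x‖ ≤ B₀' * ‖X‖)
    (hH1 : ∀ (X : XSpace d k 𝔸) (x : Site d) (κ : Fin d),
      ‖cj (U₀ x κ) (H' X (x + e κ)) - H' X x‖ ≤ B₀' * ‖X‖ * ((L : ℝ) ^ k)⁻¹)
    (h119a : ∀ (x : Site d) (κ : Fin d), ‖cj (U₀ x κ) (lam (x + e κ)) - lam x‖ < α₄ / 2 * ((L : ℝ) ^ k)⁻¹)
    (h119b : ∀ x : Site d, ‖lam x‖ < α₄ / 2)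
    (hu₁ : InLambda L U₀ u₁ k α₃ (((L : ℝ) ^ k)⁻¹))
    (hα₃ : 0 ≤ α₃) (hα₃' : α₃ ≤ 1 / 200)
    (hs₁ : 200 * C6 d * (2 * α₄) ≤ 1) (hs₂ : 12000 * ((d : ℝ) + 1) * L * (2 * α₄) ≤ 1)
    (hs₃ : C4G d L * (α₀ + α₃ + 4 * (2 * α₄)) ≤ 1)
    (hs₄ : 1024 * ((d : ℝ) + 1) * ((d : ℝ) + 4) * L ^ 2 * α₀ ≤ 1) (hs₅ : 32 * ((d : ℝ) + 1) ^ 2 * C6 d * L ^ 2 * α₀ ≤ 1)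
    (hs₆ : 16 * d * C5' d * C6 d * (L : ℝ) ^ 2 * α₀ ≤ 1) (hs₇ : 8 * d * C6 d * L * α₀ ≤ 1)
    (hsm : α₃ + α₄ ≤ 1 / (4 * B₀' * (2 * C2p d)))
    {X Y : XSpace d k 𝔸} (hX : ‖X‖ ≤ α₄ / (2 * B₀')) (hY : ‖Y‖ ≤ α₄ / (2 * B₀')) :
    ‖fpMap L U₀ u₁ k H' lam X - fpMap L U₀ u₁ k H' lam Y‖ ≤ 1 / 2 * ‖X - Y‖ := by
  have hα₄ : 0 < α₄ := by linarith [norm_nonneg (lam 0), h119b 0]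
  have hs : (0 : ℝ) ≤ ((L : ℝ) ^ k)⁻¹ := by positivity
  have hC2 : 0 ≤ C2p d := C2p_nonneg d
  have hC6 : (0 : ℝ) ≤ C6 d := by unfold C6; linarith [one_le_C5 (d := d)]
  have hC2pos : 0 < C2p d := by
    have hC6' : (2 : ℝ) ≤ C6 d := by unfold C6; linarith [one_le_C5 (d := d)]
    unfold C2p Cgen; positivity
  have hC4G : 0 ≤ C4G d L := by
    have h7 : (0 : ℝ) ≤ C7 d := by unfold C7 C6; linarith [one_le_C5 (d := d), C5'_nonneg (d := d)]
    have h4' := C4'_nonneg (d := d)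
    unfold C4G; positivity
  -- the (214)-hypotheses at `α₄` follow from those at `2α₄`
  have hs₁' : 200 * C6 d * α₄ ≤ 1 := by nlinarith
  have hs₂' : 12000 * ((d : ℝ) + 1) * L * α₄ ≤ 1 := by
    have : (0 : ℝ) ≤ 12000 * ((d : ℝ) + 1) * L := by positivity
    nlinarith
  have hs₃' : C4G d L * (α₀ + α₃ + 4 * α₄) ≤ 1 := by nlinarith
  -- print's smallness in product form
  have hprod : C2p d * (α₃ + α₄) * B₀' ≤ 1 / 8 := by
    have h1 : (α₃ + α₄) * (4 * B₀' * (2 * C2p d)) ≤ 1 := by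
      have := mul_le_mul_of_nonneg_right hsm (by positivity : (0 : ℝ) ≤ 4 * B₀' * (2 * C2p d))
      rwa [one_div, inv_mul_cancel₀ (by positivity)] at this
    nlinarith
  obtain ⟨happX, -⟩ := fpMap_apply_norm hL hG hU H' hα hα3 hα2 h52 hB hH0 hH1 h119a h119b hu₁ hα₃ hα₃' hs₁' hs₂' hs₃'
    hs₄ hs₅ hs₆ hs₇ hX
  obtain ⟨happY, -⟩ := fpMap_apply_norm hL hG hU H' hα hα3 hα2 h52 hB hH0 hH1 h119a h119b hu₁ hα₃ hα₃' hs₁' hs₂' hs₃'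
    hs₄ hs₅ hs₆ hs₇ hY
  have h2 : 2 * α₄ / 2 = α₄ := by ring
  obtain ⟨hXa, hXb⟩ := dom120_of_119 H' hB hs hH0 hH1 h119a h119b hX
  obtain ⟨hYa, hYb⟩ := dom120_of_119 H' hB hs hH0 hH1 h119a h119b hY
  have hXa' : ∀ (x : Site d) (κ : Fin d),
      ‖cj (U₀ x κ) ((lam - H' X) (x + e κ)) - (lam - H' X) x‖ < 2 * α₄ / 2 * ((L : ℝ) ^ k)⁻¹ := by rw [h2]; exact hXa
  have hYa' : ∀ (x : Site d) (κ : Fin d),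
      ‖cj (U₀ x κ) ((lam - H' Y) (x + e κ)) - (lam - H' Y) x‖ < 2 * α₄ / 2 * ((L : ℝ) ^ k)⁻¹ := by rw [h2]; exact hYa
  have hXb' : ∀ x : Site d, ‖(lam - H' X) x‖ < 2 * α₄ / 2 := by rw [h2]; exact hXb
  have hYb' : ∀ x : Site d, ‖(lam - H' Y) x‖ < 2 * α₄ / 2 := by rw [h2]; exact hYb
  have hdiff : lam - H' X - (lam - H' Y) = H' (Y - X) := by rw [map_sub]; abel
  have hma : ∀ (x : Site d) (κ : Fin d),
      ‖cj (U₀ x κ) ((lam - H' X - (lam - H' Y)) (x + e κ)) - (lam - H' X - (lam - H' Y)) x‖ ≤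
        B₀' * ‖X - Y‖ * ((L : ℝ) ^ k)⁻¹ := fun x κ => by
    rw [hdiff, norm_sub_rev X Y]; exact hH1 (Y - X) x κ
  have hmb : ∀ x : Site d, ‖(lam - H' X - (lam - H' Y)) x‖ ≤ B₀' * ‖X - Y‖ := fun x => by
    rw [hdiff, norm_sub_rev X Y]; exact hH0 (Y - X) x
  have hlip := lipschitz1122 hL hG hU (lam - H' X) (lam - H' Y) hα hα3 hα2 h52 hXa' hXb' hYa' hYb' hma hmb hu₁ hα₃ hα₃'
    hs₁ hs₂ hs₃ hs₄ hs₅ hs₆ hs₇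
  have hκ : C2p d * (2 * (B₀' * ‖X - Y‖)) * (α₃ + 2 * α₄) ≤ 1 / 2 * ‖X - Y‖ := by
    have hXY := norm_nonneg (X - Y)
    nlinarith [mul_nonneg (mul_nonneg hC2 hB.le) hXY, mul_nonneg hα₃ hXY]
  refine (BoundedContinuousFunction.norm_le (by positivity)).2 fun p => ?_
  have hLr : (1 : ℝ) ≤ L := by exact_mod_cast le_trans (by norm_num) hL
  have ht : (L : ℝ) ^ (p.1 : ℕ) * ((L : ℝ) ^ k)⁻¹ ≤ 1 := by
    rw [← div_eq_mul_inv, div_le_one (by positivity)]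
    exact pow_le_pow_right₀ hLr (Nat.le_of_lt_succ p.1.isLt)
  rw [BoundedContinuousFunction.coe_sub, Pi.sub_apply, happX p, happY p]
  have h := hlip p.1 (Nat.le_of_lt_succ p.1.isLt) p.2
  have h0 : 0 ≤ C2p d * (2 * (B₀' * ‖X - Y‖)) * (α₃ + 2 * α₄) := by positivity
  calc _ ≤ _ := h
    _ ≤ C2p d * (2 * (B₀' * ‖X - Y‖)) * (α₃ + 2 * α₄) * 1 := mul_le_mul_of_nonneg_left ht h0
    _ ≤ 1 / 2 * ‖X - Y‖ := by rw [mul_one]; exact hκ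

end FpMap

/-! ## §2 (1.118) along holomorphic families -/

section FpComp

variable {𝔸 : Type*} [NormedRing 𝔸] [NormOneClass 𝔸] [NormedAlgebra ℂ 𝔸] [CompleteSpace 𝔸]

/-- **(1.118) along holomorphic families.**  With `H′` abstract (a `ℂ`-linear map `XSpace → (ℤᵈ → 𝔸)` with `‖(H′X)(x)‖ ≤ B′₀‖X‖`,
`‖R(U₀(b))(H′X)(b₊) − (H′X)(b₋)‖ ≤ B′₀‖X‖η`), a sitewise-holomorphic family `γ` on an open `V` with values in the half-size set
(1.119) (`< ½α₄η`, `< ½α₄`), and a holomorphic `X : V → XSpace` with `‖X(t)‖ ≤ α₄/(2B′₀)`: the map `t ↦ C′(γ(t) − H′X(t))`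
(= `fpMap … (γ t) (X t)`) is complex differentiable on `V` — (1.119) ⇒ (1.120) (`dom120_of_119`) puts `γ(t) − H′X(t)` in the
(207)-domain, it is sitewise holomorphic because `X ↦ (H′X)(x)` is a bounded linear map, and `differentiableOn_CnlF_comp` applies.
[cite: Balaban1985RegularSpaces, (1.118)–(1.120) p.96, (1.124) p.97] -/
theorem differentiableOn_fpMap_comp {L : ℕ} (hL : 2 ≤ L) {G : Subgroup 𝔸ˣ} (hG : AvgClosed d L G) {U₀ : Site d → Fin d → 𝔸ˣ}
    (hU : ∀ x κ, U₀ x κ ∈ G) {k : ℕ} (H' : XSpace d k 𝔸 →ₗ[ℂ] (Site d → 𝔸))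
    {u₁ : Site d → 𝔸ˣ} {α₀ α₃ α₄ B₀' : ℝ}
    (hα : 0 < α₀) (hα3 : C0 d * α₀ ≤ 1 / 3) (hα2 : 2 * α₀ ≤ c2' d L)
    (h52 : pdev U₀ < α₀ * (((L : ℝ) ^ k)⁻¹) ^ 2)
    (hB : 0 < B₀')
    (hH0 : ∀ (X : XSpace d k 𝔸) (x : Site d), ‖H' X x‖ ≤ B₀' * ‖X‖)
    (hH1 : ∀ (X : XSpace d k 𝔸) (x : Site d) (κ : Fin d),
      ‖cj (U₀ x κ) (H' X (x + e κ)) - H' X x‖ ≤ B₀' * ‖X‖ * ((L : ℝ) ^ k)⁻¹)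
    {γ : ℂ → Site d → 𝔸} {V : Set ℂ} (hV : IsOpen V) (hγ : ∀ x, DifferentiableOn ℂ (fun t => γ t x) V)
    (h119a : ∀ t ∈ V, ∀ (x : Site d) (κ : Fin d), ‖cj (U₀ x κ) (γ t (x + e κ)) - γ t x‖ < α₄ / 2 * ((L : ℝ) ^ k)⁻¹)
    (h119b : ∀ t ∈ V, ∀ x : Site d, ‖γ t x‖ < α₄ / 2)
    (hu₁ : InLambda L U₀ u₁ k α₃ (((L : ℝ) ^ k)⁻¹))
    (hα₃ : 0 ≤ α₃) (hα₃' : α₃ ≤ 1 / 200)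
    (hs₁ : 200 * C6 d * α₄ ≤ 1) (hs₂ : 12000 * ((d : ℝ) + 1) * L * α₄ ≤ 1) (hs₃ : C4G d L * (α₀ + α₃ + 4 * α₄) ≤ 1)
    (hs₄ : 1024 * ((d : ℝ) + 1) * ((d : ℝ) + 4) * L ^ 2 * α₀ ≤ 1) (hs₅ : 32 * ((d : ℝ) + 1) ^ 2 * C6 d * L ^ 2 * α₀ ≤ 1)
    (hs₆ : 16 * d * C5' d * C6 d * (L : ℝ) ^ 2 * α₀ ≤ 1) (hs₇ : 8 * d * C6 d * L * α₀ ≤ 1)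
    {X : ℂ → XSpace d k 𝔸} (hXd : DifferentiableOn ℂ X V) (hXb : ∀ t ∈ V, ‖X t‖ ≤ α₄ / (2 * B₀')) :
    DifferentiableOn ℂ (fun t => fpMap L U₀ u₁ k H' (γ t) (X t)) V := by
  have hs : (0 : ℝ) ≤ ((L : ℝ) ^ k)⁻¹ := by positivity
  -- the shifted family `μ(t) = γ(t) − H′X(t)` is sitewise holomorphic on `V`
  have hμ : ∀ x, DifferentiableOn ℂ (fun t => (γ t - H' (X t)) x) V := by
    intro x
    let Hx : XSpace d k 𝔸 →L[ℂ] 𝔸 :=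
      ((LinearMap.proj x : (Site d → 𝔸) →ₗ[ℂ] 𝔸).comp H').mkContinuous B₀' fun Y => by
        simpa using hH0 Y x
    have hHx : ∀ Y, Hx Y = H' Y x := fun Y => rfl
    have h1 : DifferentiableOn ℂ (fun t => H' (X t) x) V := by
      have h := Hx.differentiable.comp_differentiableOn hXd
      simpa only [Function.comp_def, hHx] using h
    have h2 : DifferentiableOn ℂ (fun t => γ t x - H' (X t) x) V := (hγ x).fun_sub h1
    exact h2
  -- … and lies in the (207)-domain by (1.119) ⇒ (1.120)
  have hdom : ∀ t ∈ V,
      (∀ (x : Site d) (κ : Fin d), ‖cj (U₀ x κ) ((γ t - H' (X t)) (x + e κ)) - (γ t - H' (X t)) x‖ < α₄ * ((L : ℝ) ^ k)⁻¹) ∧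
        ∀ x : Site d, ‖(γ t - H' (X t)) x‖ < α₄ :=
    fun t ht => dom120_of_119 H' hB hs hH0 hH1 (h119a t ht) (h119b t ht) (hXb t ht)
  have h := differentiableOn_CnlF_comp (γ := fun t => γ t - H' (X t)) hL hG hU hV hμ hα hα3 hα2 h52
    (fun t ht => (hdom t ht).1) (fun t ht => (hdom t ht).2) hu₁ hα₃ hα₃' hs₁ hs₂ hs₃ hs₄ hs₅ hs₆ hs₇
  simpa only [fpMap] using h


end FpComp

/-! ## §3 The Picard iterates of (1.118) along a holomorphic family: in the ball, holomorphic, geometrically convergent to `D′` -/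

section Picard

variable {𝔸 : Type*} [NormedRing 𝔸] [NormOneClass 𝔸] [NormedAlgebra ℂ 𝔸] [CompleteSpace 𝔸]

/-- **The contraction-mapping iteration behind «exactly one solution of Eq. (1.117)» (p. 97), run along a holomorphic family.**
For `γ` sitewise holomorphic on an open `V ⊂ ℂ` with values in the half-size set (1.119), `H′` abstract with the modulus bounds, and the
hypotheses of `B8Eq1117Concrete.eq1117_existsUnique` (print's smallness `α₃ + α₄ ≦ 1/(4B′₀C′₂)`, `C′₂ = 2·C2p d`): the Picard
iterates `X₀ = 0`, `X_{n+1}(t) = C′(γ(t) − H′X_n(t))` of the transformation (1.118) (i) stay in the ball `‖X‖ ≤ α₄/(2B′₀)` («maps the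
set (1.119) of X's into itself»), (ii) are complex differentiable on `V` as `XSpace`-valued maps (`differentiableOn_fpMap_comp`,
inductively), and (iii) satisfy `‖X_n(t) − D′(γ(t))‖ ≤ 2⁻ⁿ·α₄/(2B′₀)` («is contractive on this set», constant `½`, against the fixed
point `D′(γ(t))` of `B8Eq1113Concrete.Dprime_spec`).
[cite: Balaban1985RegularSpaces, p.97 (contraction mapping theorem for (1.117); «This solution is an analytic function of λ»), (1.118)–(1.119) p.96] -/
theorem picard_iterate {L : ℕ} (hL : 2 ≤ L) {G : Subgroup 𝔸ˣ} (hG : AvgClosed d L G) {U₀ : Site d → Fin d → 𝔸ˣ}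
    (hU : ∀ x κ, U₀ x κ ∈ G) {k : ℕ} (H' : XSpace d k 𝔸 →ₗ[ℂ] (Site d → 𝔸))
    {u₁ : Site d → 𝔸ˣ} {α₀ α₃ α₄ B₀' : ℝ}
    (hα : 0 < α₀) (hα3 : C0 d * α₀ ≤ 1 / 3) (hα2 : 2 * α₀ ≤ c2' d L)
    (h52 : pdev U₀ < α₀ * (((L : ℝ) ^ k)⁻¹) ^ 2)
    (hB : 0 < B₀')
    (hH0 : ∀ (X : XSpace d k 𝔸) (x : Site d), ‖H' X x‖ ≤ B₀' * ‖X‖)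
    (hH1 : ∀ (X : XSpace d k 𝔸) (x : Site d) (κ : Fin d),
      ‖cj (U₀ x κ) (H' X (x + e κ)) - H' X x‖ ≤ B₀' * ‖X‖ * ((L : ℝ) ^ k)⁻¹)
    {γ : ℂ → Site d → 𝔸} {V : Set ℂ} (hV : IsOpen V) (hγ : ∀ x, DifferentiableOn ℂ (fun t => γ t x) V)
    (h119a : ∀ t ∈ V, ∀ (x : Site d) (κ : Fin d), ‖cj (U₀ x κ) (γ t (x + e κ)) - γ t x‖ < α₄ / 2 * ((L : ℝ) ^ k)⁻¹)
    (h119b : ∀ t ∈ V, ∀ x : Site d, ‖γ t x‖ < α₄ / 2)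
    (hu₁ : InLambda L U₀ u₁ k α₃ (((L : ℝ) ^ k)⁻¹))
    (hα₃ : 0 ≤ α₃) (hα₃' : α₃ ≤ 1 / 200) (hα₄ : 0 < α₄)
    (hs₁ : 200 * C6 d * (2 * α₄) ≤ 1) (hs₂ : 12000 * ((d : ℝ) + 1) * L * (2 * α₄) ≤ 1)
    (hs₃ : C4G d L * (α₀ + α₃ + 4 * (2 * α₄)) ≤ 1)
    (hs₄ : 1024 * ((d : ℝ) + 1) * ((d : ℝ) + 4) * L ^ 2 * α₀ ≤ 1) (hs₅ : 32 * ((d : ℝ) + 1) ^ 2 * C6 d * L ^ 2 * α₀ ≤ 1)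
    (hs₆ : 16 * d * C5' d * C6 d * (L : ℝ) ^ 2 * α₀ ≤ 1) (hs₇ : 8 * d * C6 d * L * α₀ ≤ 1)
    (hsm : α₃ + α₄ ≤ 1 / (4 * B₀' * (2 * C2p d))) (n : ℕ) :
    (∀ t ∈ V, ‖(fpMap L U₀ u₁ k H' (γ t))^[n] 0‖ ≤ α₄ / (2 * B₀')) ∧
      DifferentiableOn ℂ (fun t => (fpMap L U₀ u₁ k H' (γ t))^[n] 0) V ∧
      ∀ t ∈ V, ‖(fpMap L U₀ u₁ k H' (γ t))^[n] 0 - Dprime L U₀ u₁ k H' (α₄ / (2 * B₀')) (γ t)‖ ≤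
        (1 / 2) ^ n * (α₄ / (2 * B₀')) := by
  have hC2 : 0 ≤ C2p d := C2p_nonneg d
  have hC6 : (0 : ℝ) ≤ C6 d := by unfold C6; linarith [one_le_C5 (d := d)]
  have hC4G : 0 ≤ C4G d L := by
    have h7 : (0 : ℝ) ≤ C7 d := by unfold C7 C6; linarith [one_le_C5 (d := d), C5'_nonneg (d := d)]
    have h4' := C4'_nonneg (d := d)
    unfold C4G; positivity
  have hC2pos : 0 < C2p d := by
    have hC6' : (2 : ℝ) ≤ C6 d := by unfold C6; linarith [one_le_C5 (d := d)]
    unfold C2p Cgen; positivity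
  -- the (214)-hypotheses at `α₄` follow from those at `2α₄`
  have hs₁' : 200 * C6 d * α₄ ≤ 1 := by nlinarith
  have hs₂' : 12000 * ((d : ℝ) + 1) * L * α₄ ≤ 1 := by
    have : (0 : ℝ) ≤ 12000 * ((d : ℝ) + 1) * L := by positivity
    nlinarith
  have hs₃' : C4G d L * (α₀ + α₃ + 4 * α₄) ≤ 1 := by nlinarith
  -- print's smallness in product form and the self-map inequality `C′₂(α₃ + α₄)α₄ ≤ α₄/(2B′₀)`
  have hprod : C2p d * (α₃ + α₄) * B₀' ≤ 1 / 8 := by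
    have h1 : (α₃ + α₄) * (4 * B₀' * (2 * C2p d)) ≤ 1 := by
      have := mul_le_mul_of_nonneg_right hsm (by positivity : (0 : ℝ) ≤ 4 * B₀' * (2 * C2p d))
      rwa [one_div, inv_mul_cancel₀ (by positivity)] at this
    nlinarith
  have hle : C2p d * (α₃ + α₄) * α₄ ≤ α₄ / (2 * B₀') := by
    rw [le_div_iff₀ (by positivity)]
    nlinarith
  have hρ : 0 ≤ α₄ / (2 * B₀') := by positivity
  -- the fixed point `D′(γ(t))` for `t ∈ V`
  have hD : ∀ t ∈ V, ‖Dprime L U₀ u₁ k H' (α₄ / (2 * B₀')) (γ t)‖ ≤ α₄ / (2 * B₀') ∧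
      fpMap L U₀ u₁ k H' (γ t) (Dprime L U₀ u₁ k H' (α₄ / (2 * B₀')) (γ t)) =
        Dprime L U₀ u₁ k H' (α₄ / (2 * B₀')) (γ t) := fun t ht =>
    (Dprime_spec hL hG hU H' (γ t) hα hα3 hα2 h52 hB hH0 hH1 (h119a t ht) (h119b t ht) hu₁ hα₃ hα₃' hs₁ hs₂ hs₃ hs₄ hs₅
      hs₆ hs₇ hsm).1
  induction n with
  | zero =>
    refine ⟨fun t _ => by simpa using hρ, ?_, fun t ht => ?_⟩
    · simp
    · simpa using (hD t ht).1
  | succ n ih =>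
    obtain ⟨hb, hd, hc⟩ := ih
    have hstep : ∀ t, (fpMap L U₀ u₁ k H' (γ t))^[n + 1] 0 =
        fpMap L U₀ u₁ k H' (γ t) ((fpMap L U₀ u₁ k H' (γ t))^[n] 0) := fun t =>
      Function.iterate_succ_apply' _ _ _
    refine ⟨fun t ht => ?_, ?_, fun t ht => ?_⟩
    · rw [hstep]
      exact (fpMap_apply_norm hL hG hU H' hα hα3 hα2 h52 hB hH0 hH1 (h119a t ht) (h119b t ht) hu₁ hα₃ hα₃' hs₁' hs₂'
        hs₃' hs₄ hs₅ hs₆ hs₇ (hb t ht)).2.trans hle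
    · have h := differentiableOn_fpMap_comp hL hG hU H' hα hα3 hα2 h52 hB hH0 hH1 hV hγ h119a h119b hu₁ hα₃ hα₃' hs₁'
        hs₂' hs₃' hs₄ hs₅ hs₆ hs₇ hd hb
      refine h.congr fun t _ => ?_
      exact hstep t
    · rw [hstep]
      obtain ⟨hDb, hDfix⟩ := hD t ht
      have heq : fpMap L U₀ u₁ k H' (γ t) ((fpMap L U₀ u₁ k H' (γ t))^[n] 0) -
          Dprime L U₀ u₁ k H' (α₄ / (2 * B₀')) (γ t) =
          fpMap L U₀ u₁ k H' (γ t) ((fpMap L U₀ u₁ k H' (γ t))^[n] 0) -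
            fpMap L U₀ u₁ k H' (γ t) (Dprime L U₀ u₁ k H' (α₄ / (2 * B₀')) (γ t)) := by
        rw [hDfix]
      rw [heq]
      calc _ ≤ 1 / 2 * ‖(fpMap L U₀ u₁ k H' (γ t))^[n] 0 - Dprime L U₀ u₁ k H' (α₄ / (2 * B₀')) (γ t)‖ :=
            norm_fpMap_sub_le hL hG hU H' hα hα3 hα2 h52 hB hH0 hH1 (h119a t ht) (h119b t ht) hu₁ hα₃ hα₃' hs₁ hs₂ hs₃
              hs₄ hs₅ hs₆ hs₇ hsm (hb t ht) hDb
        _ ≤ 1 / 2 * ((1 / 2) ^ n * (α₄ / (2 * B₀'))) := by gcongr; exact hc t ht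
        _ = (1 / 2) ^ (n + 1) * (α₄ / (2 * B₀')) := by ring

/-- **Uniform convergence of the Picard iterates** to `D′(γ(·))` on `V` (rate `2⁻ⁿ·α₄/(2B′₀)`).
[cite: Balaban1985RegularSpaces, p.97 (contraction mapping theorem for (1.117))] -/
theorem tendstoUniformlyOn_picard {L : ℕ} (hL : 2 ≤ L) {G : Subgroup 𝔸ˣ} (hG : AvgClosed d L G) {U₀ : Site d → Fin d → 𝔸ˣ}
    (hU : ∀ x κ, U₀ x κ ∈ G) {k : ℕ} (H' : XSpace d k 𝔸 →ₗ[ℂ] (Site d → 𝔸))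
    {u₁ : Site d → 𝔸ˣ} {α₀ α₃ α₄ B₀' : ℝ}
    (hα : 0 < α₀) (hα3 : C0 d * α₀ ≤ 1 / 3) (hα2 : 2 * α₀ ≤ c2' d L)
    (h52 : pdev U₀ < α₀ * (((L : ℝ) ^ k)⁻¹) ^ 2)
    (hB : 0 < B₀')
    (hH0 : ∀ (X : XSpace d k 𝔸) (x : Site d), ‖H' X x‖ ≤ B₀' * ‖X‖)
    (hH1 : ∀ (X : XSpace d k 𝔸) (x : Site d) (κ : Fin d),
      ‖cj (U₀ x κ) (H' X (x + e κ)) - H' X x‖ ≤ B₀' * ‖X‖ * ((L : ℝ) ^ k)⁻¹)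
    {γ : ℂ → Site d → 𝔸} {V : Set ℂ} (hV : IsOpen V) (hγ : ∀ x, DifferentiableOn ℂ (fun t => γ t x) V)
    (h119a : ∀ t ∈ V, ∀ (x : Site d) (κ : Fin d), ‖cj (U₀ x κ) (γ t (x + e κ)) - γ t x‖ < α₄ / 2 * ((L : ℝ) ^ k)⁻¹)
    (h119b : ∀ t ∈ V, ∀ x : Site d, ‖γ t x‖ < α₄ / 2)
    (hu₁ : InLambda L U₀ u₁ k α₃ (((L : ℝ) ^ k)⁻¹))
    (hα₃ : 0 ≤ α₃) (hα₃' : α₃ ≤ 1 / 200) (hα₄ : 0 < α₄)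
    (hs₁ : 200 * C6 d * (2 * α₄) ≤ 1) (hs₂ : 12000 * ((d : ℝ) + 1) * L * (2 * α₄) ≤ 1)
    (hs₃ : C4G d L * (α₀ + α₃ + 4 * (2 * α₄)) ≤ 1)
    (hs₄ : 1024 * ((d : ℝ) + 1) * ((d : ℝ) + 4) * L ^ 2 * α₀ ≤ 1) (hs₅ : 32 * ((d : ℝ) + 1) ^ 2 * C6 d * L ^ 2 * α₀ ≤ 1)
    (hs₆ : 16 * d * C5' d * C6 d * (L : ℝ) ^ 2 * α₀ ≤ 1) (hs₇ : 8 * d * C6 d * L * α₀ ≤ 1)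
    (hsm : α₃ + α₄ ≤ 1 / (4 * B₀' * (2 * C2p d))) :
    TendstoUniformlyOn (fun n t => (fpMap L U₀ u₁ k H' (γ t))^[n] 0)
      (fun t => Dprime L U₀ u₁ k H' (α₄ / (2 * B₀')) (γ t)) atTop V := by
  rw [Metric.tendstoUniformlyOn_iff]
  intro ε hε
  have hlim : Tendsto (fun n : ℕ => (1 / 2 : ℝ) ^ n * (α₄ / (2 * B₀'))) atTop (𝓝 0) := by
    simpa using (tendsto_pow_atTop_nhds_zero_of_lt_one (by norm_num : (0 : ℝ) ≤ 1 / 2)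
      (by norm_num : (1 / 2 : ℝ) < 1)).mul_const (α₄ / (2 * B₀'))
  filter_upwards [hlim.eventually (gt_mem_nhds hε)] with n hn t ht
  rw [dist_comm, dist_eq_norm]
  exact ((picard_iterate hL hG hU H' hα hα3 hα2 h52 hB hH0 hH1 hV hγ h119a h119b hu₁ hα₃ hα₃' hα₄ hs₁ hs₂ hs₃ hs₄ hs₅ hs₆
    hs₇ hsm n).2.2 t ht).trans_lt hn

end Picard

end Literature.MathematicalPhysics.QuantumFieldTheory.Balaban1983to89.B8Eq1118PicardAnalytic

end
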